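import Summits.QuantumFields.YangMills.Theorems.QuantileBitPuritySU2ClassShiftDefs
import Summits.QuantumFields.YangMills.Theorems.QuantileBitPuritySU2ClassShiftJacobian
import Summits.QuantumFields.YangMills.Theorems.WeakCouplingRatesColdBoxChart
import HarnessLib

/-!
# The own-axis shift moves class angles along rays; its one-link Jacobian bound

Support module (`--supports` stmt-QuantumFields-23948; memo HOME `bc/g14-dw/PLAN-PERIODIC.md` §C).  For the own-axis class-angle shift
`classShift θ W = exp(ι(θ · axisVec W)) · W` (defs module `QuantileBitPuritySU2ClassShiftDefs`):

* §1 `imVec ∘ imQuat = id`, `imVec` kills real parts and is linear ∕ continuous; `axisVec (exp(ι(r ω))) = ω` for unit `ω` and `sin r > 0`;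
  ★ `classShift_expPoint_smul`: `classShift θ (exp(ι(r ω))) = exp(ι((r + θ) ω))` — the RAY PROPERTY (coaxial exponentials multiply:
  `exp(ι θω) exp(ι rω) = exp(ι (θ+r)ω)`, Mathlib `exp_add_of_commute`); measurability of `axisVec`, `classShift`;
* §2 ★ `lintegral_indicator_classShift_le`: the one-link Jacobian lemma `ClassShift.lintegral_indicator_comp_shift_le`
  (`Theorems/QuantileBitPuritySU2ClassShiftJacobian.lean`) specialised to `ψ = classShift θ`: on the chart shell `0 < a ≤ ‖x‖ ≤ b < π` with
  `0 < a + θ`, `b + θ < π` and `sin² r ≤ ρ sin²(r+θ)` on `[a,b]`, `∫ 𝟙_{exp(ι shell)} · F ∘ classShift θ dHaar ≤ ρ ∫ F dHaar`; and the away-from-the-identity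
  case with `ρ = 1` (★ `lintegral_indicator_classShift_le_self`).

HONEST FRAMING: calculus on one compact group; nothing about lattice gauge theory, infinite volume, the continuum limit or the Clay gap.  No `sorry`,
no new axiom, no new definition.  References: [folklore].
-/

set_option autoImplicit false

noncomputable section

open MeasureTheory Set Metric Function NormedSpace
open scoped ENNReal Real Quaternion

namespace Summit.QuantumFields.YangMills.Theorems.FemtoTransferGap.ClassShift

open Literature.MathematicalPhysics.QuantumLattice (su2Quat quatToSU2 quatToSU2_smul)
open Literature.MathematicalPhysics.QuantumFieldTheory (haarProbability)
open Literature.MathematicalPhysics.QuantumFieldTheory.Balaban1983to89.T4HaarSU2ExpChart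
open Literature.MathematicalPhysics.QuantumFieldTheory.Balaban1983to89.T4HaarSU2Translate (continuous_su2Quat measurable_su2Quat)
open Summit.QuantumFields.YangMills.Theorems.WeakCouplingRates (quatToSU2_mul_quatToSU2)

/-! ## §1 The axis and the ray property -/

/-- `imVec (ι x) = x`. [folklore] -/
theorem imVec_imQuat (x : EuclideanSpace ℝ (Fin 3)) : imVec (imQuat x) = x := by
  ext i
  fin_cases i <;> simp [imVec, imQuat_apply]

/-- `imVec` kills real parts: `imVec (c + q) = imVec q` for real `c`. [folklore] -/
theorem imVec_coe_add (c : ℝ) (q : ℍ) : imVec ((c : ℍ) + q) = imVec q := by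
  ext i
  fin_cases i <;> simp [imVec]

/-- `imVec` is real-homogeneous. [folklore] -/
theorem imVec_smul (s : ℝ) (q : ℍ) : imVec (s • q) = s • imVec q := by
  ext i
  fin_cases i <;> simp [imVec]

/-- `imVec` is continuous. [folklore] -/
theorem continuous_imVec : Continuous imVec := by
  unfold imVec
  refine (PiLp.continuous_toLp 2 _).comp (continuous_pi fun i => ?_)
  fin_cases i
  · simpa using Quaternion.continuous_imI
  · simpa using Quaternion.continuous_imJ
  · simpa using Quaternion.continuous_imK

/-- `axisVec` is measurable. [folklore] -/
theorem measurable_axisVec : Measurable axisVec := by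
  unfold axisVec
  have h := (continuous_imVec.comp continuous_su2Quat).measurable
  exact (h.norm.inv).smul h

/-- `classShift θ` is measurable. [folklore] -/
theorem measurable_classShift (θ : ℝ) : Measurable (classShift θ) := by
  have h1 : Measurable fun W : Matrix.specialUnitaryGroup (Fin 2) ℂ => expPoint (θ • axisVec W) :=
    measurable_expPoint.comp (measurable_axisVec.const_smul θ)
  exact h1.mul measurable_id

/-- **The axis of `exp(ι(r ω))` is `ω`** (`‖ω‖ = 1`, `sin r > 0`). [folklore] -/
theorem axisVec_expPoint_smul {ω : EuclideanSpace ℝ (Fin 3)} (hω : ‖ω‖ = 1) {r : ℝ} (hr : 0 < Real.sin r) :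
    axisVec (expPoint (r • ω)) = ω := by
  unfold axisVec
  rw [su2Quat_expPoint, exp_imQuat_smul hω, imVec_coe_add, imVec_smul, imVec_imQuat, norm_smul, hω, mul_one,
    Real.norm_of_nonneg hr.le, smul_smul, inv_mul_cancel₀ hr.ne', one_smul]

/-- ★ **The ray property**: `classShift θ (exp(ι(r ω))) = exp(ι((r + θ) ω))` for unit `ω` and `sin r > 0` — the own-axis shift adds `θ` to the
class angle along the ray. [folklore] -/
theorem classShift_expPoint_smul {ω : EuclideanSpace ℝ (Fin 3)} (hω : ‖ω‖ = 1) {r : ℝ} (hr : 0 < Real.sin r) (θ : ℝ) :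
    classShift θ (expPoint (r • ω)) = expPoint ((r + θ) • ω) := by
  rw [classShift_apply, axisVec_expPoint_smul hω hr]
  have hne : ∀ y : EuclideanSpace ℝ (Fin 3), exp (imQuat y) ≠ (0 : ℍ) := fun y h => by
    have := norm_exp_imQuat y; rw [h, norm_zero] at this; exact zero_ne_one this
  have hcomm : Commute (imQuat (θ • ω)) (imQuat (r • ω)) := by
    rw [map_smul, map_smul]
    exact ((Commute.refl (imQuat ω)).smul_left θ).smul_right r
  have hball : ∀ q : ℍ, q ∈ Metric.eball (0 : ℍ) (expSeries ℝ ℍ).radius := fun q => by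
    rw [expSeries_radius_eq_top]; exact Metric.mem_eball.2 (edist_lt_top _ _)
  unfold expPoint
  rw [quatToSU2_mul_quatToSU2 (hne _) (hne _), ← exp_add_of_commute_of_mem_ball hcomm (hball _) (hball _), ← map_add, ← add_smul,
    add_comm θ r]

/-! ## §2 The one-link Jacobian bound for the own-axis shift -/

/-- ★ **One-link Jacobian bound for the own-axis shift**: on the chart shell `a ≤ ‖x‖ ≤ b` with `0 < a`, `b < π`, `0 < a + θ`, `b + θ < π`, and
`sin² r ≤ ρ sin²(r + θ)` on `[a, b]` (`ρ ≥ 0`): `∫ 𝟙_{exp(ι shell)}(U) F(classShift θ U) dHaar ≤ ρ ∫ F dHaar` for every measurable `F ≥ 0`.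
[folklore] -/
theorem lintegral_indicator_classShift_le {θ a b ρ : ℝ} (ha : 0 < a) (hbπ : b < π) (haθ : 0 < a + θ) (hbθ : b + θ < π) (hρ : 0 ≤ ρ)
    (hsin : ∀ r : ℝ, a ≤ r → r ≤ b → Real.sin r ^ 2 ≤ ρ * Real.sin (r + θ) ^ 2)
    (F : Matrix.specialUnitaryGroup (Fin 2) ℂ → ℝ≥0∞) (hF : Measurable F) :
    ∫⁻ U, (expPoint '' {x : EuclideanSpace ℝ (Fin 3) | a ≤ ‖x‖ ∧ ‖x‖ ≤ b}).indicator (fun U => F (classShift θ U)) U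
        ∂(haarProbability (Matrix.specialUnitaryGroup (Fin 2) ℂ)) ≤
      ENNReal.ofReal ρ * ∫⁻ U, F U ∂(haarProbability (Matrix.specialUnitaryGroup (Fin 2) ℂ)) :=
  lintegral_indicator_comp_shift_le (measurable_classShift θ) hbπ haθ hbθ hρ
    (fun _ hω _ har hrb => classShift_expPoint_smul hω (Real.sin_pos_of_pos_of_lt_pi (lt_of_lt_of_le ha har) (lt_of_le_of_lt hrb hbπ)) θ)
    hsin F hF

/-- ★ **Away from the identity the own-axis shift never raises Haar weight**: `θ ≥ 0`, `0 < a`, `b + θ ≤ π/2` give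
`∫ 𝟙_{exp(ι shell)}(U) F(classShift θ U) dHaar ≤ ∫ F dHaar`. [folklore] -/
theorem lintegral_indicator_classShift_le_self {θ a b : ℝ} (hθ : 0 ≤ θ) (ha : 0 < a) (hbθ : b + θ ≤ π / 2)
    (F : Matrix.specialUnitaryGroup (Fin 2) ℂ → ℝ≥0∞) (hF : Measurable F) :
    ∫⁻ U, (expPoint '' {x : EuclideanSpace ℝ (Fin 3) | a ≤ ‖x‖ ∧ ‖x‖ ≤ b}).indicator (fun U => F (classShift θ U)) U
        ∂(haarProbability (Matrix.specialUnitaryGroup (Fin 2) ℂ)) ≤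
      ∫⁻ U, F U ∂(haarProbability (Matrix.specialUnitaryGroup (Fin 2) ℂ)) := by
  have hπ := Real.pi_pos
  have h := lintegral_indicator_classShift_le (ρ := 1) ha (by linarith) (by linarith) (by linarith) zero_le_one
    (fun r har hrb => sin_sq_le_sin_sq_add hθ ha.le hbθ r har hrb) F hF
  simpa using h

end Summit.QuantumFields.YangMills.Theorems.FemtoTransferGap.ClassShift

end
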